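import Summits.QuantumFields.YangMills.Theorems.UnitScaleTiltProp7SectET3Members
import HarnessLib

/-!
# Route `UnitScaleTilt`, crux K1 «MinimiserStabilityRegPr» (stmt-QuantumFields-19200), route-R E′ path (α′), (E1-b) — MONOTONICITY OF THE MEMBER WINDOW ROW IN ITS CONSTANT `c35`

Cell `ym3-torus`, D-0154 (3c) twin-width seat `ym-routeR-w3` (gen 6) = namer of the (hK)∕(A)∕(E1-b) lineage.  The member window row of ✓p681077
`Prop7LinearCorrectorCloseHK2.linCorr_gauge_le_of_hKsup` (px4 g3's standing window, `… ≤ 1∕4`) is MONOTONE in the constant `c35`: the window at a larger constant `c35'` implies the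
window at any `0 ≤ c35 ≤ c35'`.  This is the seam letter of the (E1-b) CLOSE at the member: px22 g3's (A-cov) member theorem `hKsup_member` and px13 g4's adapter ✓p684681
`hLrow_of_hKsup_member` each produce their own `∃ c35 a₅`, and the close takes `max c35 ∕ min a₅` — `hwin_member_of_le` moves the ONE assumed window down to both suppliers.
THEOREMS ONLY (0 `def`, 0 `sorry`); `--supports stmt-QuantumFields-19200`, count-neutral.  YM₃ on T³ is a ladder rung (R3), not the Clay problem; nothing here claims the stub, the crux,
d = 4 or the gap.

WHAT IS PROVED (ns `…Theorems.Prop7WindowMono`): `sq_comb_mono`, `mul_exp_mono`, ★`windowTerm_mono` (the `c35`-dependent summand is monotone), ★★`hwin_mono` (abstract shape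
`A·(D·(B + Y(c))) ≤ 1∕4`, `0 ≤ A, D`), ★★★`hwin_member_of_le` (the member window VERBATIM: at `c35'` ⟹ at `c35 ≤ c35'`).

References: T. Bałaban, CMP 102 (1985) 277–309 [Balaban1985Variational] (Prop. 7 p.299; the window is the smallness regime of (1.36) of CMP 99 (1985) 75–102 [Balaban1985RegularSpaces] p.82).
-/

set_option autoImplicit false

noncomputable section

namespace Summit.QuantumFields.YangMills.Theorems.Prop7WindowMono

open Literature.MathematicalPhysics.QuantumFieldTheory.Balaban1983to89.B6GlobalChartV1 (PV)
open Summit.QuantumFields.YangMills.Theorems.Prop7SectET3Members (hd3)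

/-- `(2a + 4b²)²` is monotone in `a, b ≥ 0`. -/
theorem sq_comb_mono {a a' b b' : ℝ} (ha0 : 0 ≤ a) (hb0 : 0 ≤ b) (ha : a ≤ a') (hb : b ≤ b') :
    (2 * a + 4 * b ^ 2) ^ 2 ≤ (2 * a' + 4 * b' ^ 2) ^ 2 := by
  have hbb : b ^ 2 ≤ b' ^ 2 := pow_le_pow_left₀ hb0 hb 2
  have h0 : 0 ≤ 2 * a + 4 * b ^ 2 := by positivity
  exact pow_le_pow_left₀ h0 (by linarith) 2

/-- `t ↦ s·t·exp t'`-type monotonicity: for `0 ≤ s`, `0 ≤ t ≤ t'`, `s·t·exp t ≤ s·t'·exp t'`. -/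
theorem mul_exp_mono {s t t' : ℝ} (hs : 0 ≤ s) (ht0 : 0 ≤ t) (ht : t ≤ t') :
    s * t * Real.exp t ≤ s * t' * Real.exp t' := by
  have hexp : Real.exp t ≤ Real.exp t' := Real.exp_le_exp.mpr ht
  exact mul_le_mul (mul_le_mul_of_nonneg_left ht hs) hexp (Real.exp_pos _).le (mul_nonneg hs (le_trans ht0 ht))

/-- ★ The `c35`-dependent summand of the member window row is monotone in `c` (all other atoms `u, M, α₀ ≥ 0` fixed). -/
theorem windowTerm_mono {u M α₀ c c' : ℝ} (hu : 0 ≤ u) (hM : 0 ≤ M) (hα : 0 ≤ α₀) (hc : 0 ≤ c) (hcc : c ≤ c') :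
    (2 * (u * (u * (c * M * α₀)) * Real.exp (u * (c * M * α₀))) + 4 * (u * (c * M * α₀) * Real.exp (u * (c * M * α₀))) ^ 2) ^ 2
      ≤ (2 * (u * (u * (c' * M * α₀)) * Real.exp (u * (c' * M * α₀))) + 4 * (u * (c' * M * α₀) * Real.exp (u * (c' * M * α₀))) ^ 2) ^ 2 := by
  have ht0 : 0 ≤ c * M * α₀ := mul_nonneg (mul_nonneg hc hM) hα
  have ht : c * M * α₀ ≤ c' * M * α₀ := mul_le_mul_of_nonneg_right (mul_le_mul_of_nonneg_right hcc hM) hα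
  have hut0 : 0 ≤ u * (c * M * α₀) := mul_nonneg hu ht0
  have hut : u * (c * M * α₀) ≤ u * (c' * M * α₀) := mul_le_mul_of_nonneg_left ht hu
  have hb : u * (c * M * α₀) * Real.exp (u * (c * M * α₀)) ≤ u * (c' * M * α₀) * Real.exp (u * (c' * M * α₀)) := by
    have := mul_exp_mono (s := 1) zero_le_one hut0 hut
    simpa only [one_mul] using this
  have ha : u * (u * (c * M * α₀)) * Real.exp (u * (c * M * α₀)) ≤ u * (u * (c' * M * α₀)) * Real.exp (u * (c' * M * α₀)) :=
    mul_exp_mono hu hut0 hut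
  exact sq_comb_mono (mul_nonneg (mul_nonneg hu hut0) (Real.exp_pos _).le) (mul_nonneg hut0 (Real.exp_pos _).le) ha hb

/-- ★★ ABSTRACT WINDOW MONOTONICITY.  In the shape `A·(D·(B + Y(c))) ≤ 1∕4` of the member window row (`0 ≤ A`, `0 ≤ D`; `B` arbitrary), the row at `c'` implies the row at any `0 ≤ c ≤ c'`. -/
theorem hwin_mono {A D B u M α₀ c c' : ℝ} (hA : 0 ≤ A) (hD : 0 ≤ D) (hu : 0 ≤ u) (hM : 0 ≤ M) (hα : 0 ≤ α₀) (hc : 0 ≤ c) (hcc : c ≤ c')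
    (h : A * (D * (B + (2 * (u * (u * (c' * M * α₀)) * Real.exp (u * (c' * M * α₀))) + 4 * (u * (c' * M * α₀) * Real.exp (u * (c' * M * α₀))) ^ 2) ^ 2)) ≤ 1 / 4) :
    A * (D * (B + (2 * (u * (u * (c * M * α₀)) * Real.exp (u * (c * M * α₀))) + 4 * (u * (c * M * α₀) * Real.exp (u * (c * M * α₀))) ^ 2) ^ 2)) ≤ 1 / 4 :=
  le_trans (mul_le_mul_of_nonneg_left (mul_le_mul_of_nonneg_left ((add_le_add_iff_left B).mpr (windowTerm_mono hu hM hα hc hcc)) hD) hA) h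

/-- ★★★ **THE MEMBER WINDOW ROW IS MONOTONE IN `c35`.**  px4 g3's standing window row of the `RegPr` member `PV 2 ℓ m K hd3 hL` (VERBATIM the `hwin` binder of ✓p681077 `linCorr_gauge_le_of_hKsup`,
✓p680458 `weight_row_member_all_scales`, ✓p684681 `hLrow_of_hKsup_member`) at constant `c35'` implies the same row at any constant `0 ≤ c35 ≤ c35'` (`0 ≤ α₀`).  Use: the (E1-b) CLOSE
assumes the window at `max c35₁ c35₂` and feeds `hwin_member_of_le … (le_max_left _ _) hwin` ∕ `(le_max_right _ _)` to its two suppliers.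
[cite: Balaban1985Variational, Prop. 7 p.299; Balaban1985RegularSpaces, (1.36) p.82] -/
theorem hwin_member_of_le {ℓ : ℕ} {hL : Odd (ℓ + 1) ∧ 1 < ℓ + 1} (m n K a' : ℕ) {α₀ c35 c35' : ℝ} (hα₀ : 0 ≤ α₀) (hc35 : 0 ≤ c35) (hcc : c35 ≤ c35')
    (hwin : (4 * 2197 * (24 * 289 * 24576 * 46116) : ℝ) * ((2 : ℕ) : ℝ) ^ 2 * ((((PV 2 ℓ m K hd3 hL).L : ℝ)) ^ (K - n)) ^ 4
            * ((((PV 2 ℓ m K hd3 hL).d : ℝ)) ^ 2 * (4 * ((2 : ℕ) : ℝ) * (α₀ * ((((PV 2 ℓ m K hd3 hL).L : ℝ))⁻¹) ^ (2 * (K - n))) ^ 2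
              + (2 * ((((ℓ + 1 : ℕ) : ℝ) ^ (K - n))⁻¹ * ((((ℓ + 1 : ℕ) : ℝ) ^ (K - n))⁻¹ * (c35' * (((ℓ + 1 : ℕ) : ℝ) * (((ℓ + 1) ^ a' : ℕ) : ℝ)) * α₀))
                  * Real.exp ((((ℓ + 1 : ℕ) : ℝ) ^ (K - n))⁻¹ * (c35' * (((ℓ + 1 : ℕ) : ℝ) * (((ℓ + 1) ^ a' : ℕ) : ℝ)) * α₀)))
                + 4 * ((((ℓ + 1 : ℕ) : ℝ) ^ (K - n))⁻¹ * (c35' * (((ℓ + 1 : ℕ) : ℝ) * (((ℓ + 1) ^ a' : ℕ) : ℝ)) * α₀)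
                  * Real.exp ((((ℓ + 1 : ℕ) : ℝ) ^ (K - n))⁻¹ * (c35' * (((ℓ + 1 : ℕ) : ℝ) * (((ℓ + 1) ^ a' : ℕ) : ℝ)) * α₀))) ^ 2) ^ 2)) ≤ 1 / 4) :
    (4 * 2197 * (24 * 289 * 24576 * 46116) : ℝ) * ((2 : ℕ) : ℝ) ^ 2 * ((((PV 2 ℓ m K hd3 hL).L : ℝ)) ^ (K - n)) ^ 4
            * ((((PV 2 ℓ m K hd3 hL).d : ℝ)) ^ 2 * (4 * ((2 : ℕ) : ℝ) * (α₀ * ((((PV 2 ℓ m K hd3 hL).L : ℝ))⁻¹) ^ (2 * (K - n))) ^ 2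
              + (2 * ((((ℓ + 1 : ℕ) : ℝ) ^ (K - n))⁻¹ * ((((ℓ + 1 : ℕ) : ℝ) ^ (K - n))⁻¹ * (c35 * (((ℓ + 1 : ℕ) : ℝ) * (((ℓ + 1) ^ a' : ℕ) : ℝ)) * α₀))
                  * Real.exp ((((ℓ + 1 : ℕ) : ℝ) ^ (K - n))⁻¹ * (c35 * (((ℓ + 1 : ℕ) : ℝ) * (((ℓ + 1) ^ a' : ℕ) : ℝ)) * α₀)))
                + 4 * ((((ℓ + 1 : ℕ) : ℝ) ^ (K - n))⁻¹ * (c35 * (((ℓ + 1 : ℕ) : ℝ) * (((ℓ + 1) ^ a' : ℕ) : ℝ)) * α₀)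
                  * Real.exp ((((ℓ + 1 : ℕ) : ℝ) ^ (K - n))⁻¹ * (c35 * (((ℓ + 1 : ℕ) : ℝ) * (((ℓ + 1) ^ a' : ℕ) : ℝ)) * α₀))) ^ 2) ^ 2)) ≤ 1 / 4 :=
  by
  refine hwin_mono ?_ ?_ ?_ ?_ hα₀ hc35 hcc hwin
  · positivity
  · positivity
  · positivity
  · positivity

end Summit.QuantumFields.YangMills.Theorems.Prop7WindowMono

end
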